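import Summits.Ventures.Crystal3D.Theorems.StickyWulffConstantPolycrystalWulffBoundArrangementRefinementFull
import Summits.Ventures.Crystal3D.Theorems.StickyWulffConstantPolycrystalWulffBoundPolyRefinementOfVolume

/-!
# `PolycrystalWulffBound`: turnkey FULL refinement of a polyhedral texture (raw pieces, finite volume)

Route `StickyWulffConstant` of the venture `Summits/Ventures/Crystal3D`, crux `PolycrystalWulffBound`
(item `stmt-Ventures-19482`), second prover lane; the multi-grain analogue of
`exists_disjoint_polytope_refinement_of_volume_lt_top` (`…PolyRefinementOfVolume.lean`) on top of
`exists_disjoint_polytope_refinement_full` (`…ArrangementRefinementFull.lean`).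

Input: a finite family `𝒢 : Finset (Finset (E × ℝ))` of RAW constraint sets (a texture's pieces, all
grains pooled; normals need not be unit, pieces may be degenerate/overlapping) whose polyhedral set
`⋃_{G ∈ 𝒢} polytope G` has finite volume.  Output (`exists_full_refinement_of_volume_lt_top`):
nonempty bounded open polytopes `Q_j` with unit normals and distinct facet planes, pairwise disjoint,
antisymmetric unit common-plane normals, inside the set and exhausting it a.e., the dichotomy
`Q_j ⊆ polytope G ∨ Disjoint Q_j (polytope G)` for every RAW piece `G ∈ 𝒢`, and the a.e. decomposition
of EVERY raw sub-family `𝒢' ⊆ 𝒢` (one grain) into the cells it contains — i.e. everything clause (B),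
`per_biUnion_eq_of_polytopeCalculus` and `per_add_per_sub_per_union_eq_crossSum_of_polytopeCalculus`
consume, with no hypothesis left on the texture but `Poly` + finite volume.
WHAT THIS IS NOT: the facet calculus; nothing on the crux beyond bookkeeping.
-/

noncomputable section

namespace Summit.Ventures.Crystal3D.Theorems

open MeasureTheory Set
open scoped RealInnerProductSpace Classical ENNReal

variable {E : Type*} [NormedAddCommGroup E] [InnerProductSpace ℝ E] [FiniteDimensional ℝ E]
  [MeasurableSpace E] [BorelSpace E]

/-- **Turnkey full refinement of a raw polyhedral texture of finite volume.** -/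
theorem exists_full_refinement_of_volume_lt_top (𝒢 : Finset (Finset (E × ℝ)))
    (hv : volume (⋃ G ∈ 𝒢, ⋂ p ∈ G, {x : E | ⟪p.1, x⟫ < p.2}) < ⊤) :
    ∃ (k : ℕ) (H : Fin k → Finset (E × ℝ)) (ν : Fin k → Fin k → E),
      (∀ j, (⋂ q ∈ H j, {x : E | ⟪q.1, x⟫ < q.2}).Nonempty) ∧
      (∀ i j, ν j i = -ν i j) ∧
      (∀ j, Bornology.IsBounded (⋂ q ∈ H j, {x : E | ⟪q.1, x⟫ < q.2})) ∧
      (∀ j, ∀ q ∈ H j, ‖q.1‖ = 1) ∧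
      (∀ j, ∀ q ∈ H j, ∀ q' ∈ H j, q ≠ q' →
        {x : E | ⟪q.1, x⟫ = q.2} ≠ {x : E | ⟪q'.1, x⟫ = q'.2}) ∧
      (∀ j j', j ≠ j' → Disjoint (⋂ q ∈ H j, {x : E | ⟪q.1, x⟫ < q.2})
        (⋂ q ∈ H j', {x : E | ⟪q.1, x⟫ < q.2})) ∧
      (∀ j j', j ≠ j' → ‖ν j j'‖ = 1 ∧ ∃ b : ℝ,
        closure (⋂ q ∈ H j, {x : E | ⟪q.1, x⟫ < q.2}) ∩
          closure (⋂ q ∈ H j', {x : E | ⟪q.1, x⟫ < q.2}) ⊆ {x : E | ⟪ν j j', x⟫ = b}) ∧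
      (∀ j, (⋂ q ∈ H j, {x : E | ⟪q.1, x⟫ < q.2}) ⊆ ⋃ G ∈ 𝒢, ⋂ p ∈ G, {x : E | ⟪p.1, x⟫ < p.2}) ∧
      ((⋃ G ∈ 𝒢, ⋂ p ∈ G, {x : E | ⟪p.1, x⟫ < p.2}) =ᵐ[volume]
        ⋃ j, ⋂ q ∈ H j, {x : E | ⟪q.1, x⟫ < q.2}) ∧
      (∀ j, ∀ G ∈ 𝒢,
        (⋂ q ∈ H j, {x : E | ⟪q.1, x⟫ < q.2}) ⊆ (⋂ p ∈ G, {x : E | ⟪p.1, x⟫ < p.2}) ∨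
        Disjoint (⋂ q ∈ H j, {x : E | ⟪q.1, x⟫ < q.2}) (⋂ p ∈ G, {x : E | ⟪p.1, x⟫ < p.2})) ∧
      (∀ 𝒢' : Finset (Finset (E × ℝ)), 𝒢' ⊆ 𝒢 →
        (⋃ G ∈ 𝒢', ⋂ p ∈ G, {x : E | ⟪p.1, x⟫ < p.2}) =ᵐ[volume]
          ⋃ (j) (_ : ∃ G ∈ 𝒢', (⋂ q ∈ H j, {x : E | ⟪q.1, x⟫ < q.2}) ⊆ ⋂ p ∈ G, {x : E | ⟪p.1, x⟫ < p.2}),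
            ⋂ q ∈ H j, {x : E | ⟪q.1, x⟫ < q.2}) := by
  -- normalisation of the non-degenerate pieces
  set nrm : Finset (E × ℝ) → Finset (E × ℝ) := fun G =>
    (G.filter (fun p => p.1 ≠ 0)).image (fun p : E × ℝ => (‖p.1‖⁻¹ • p.1, ‖p.1‖⁻¹ * p.2)) with hnrm
  set good : Finset (Finset (E × ℝ)) := 𝒢.filter (fun G => ∀ p ∈ G, p.1 = 0 → 0 < p.2) with hgood
  set 𝒢n : Finset (Finset (E × ℝ)) := good.image nrm with h𝒢n
  set 𝓗 : Finset (E × ℝ) := good.biUnion nrm with h𝓗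
  -- raw pieces vs normalised pieces
  have hpoly_good : ∀ G ∈ good, (⋂ p ∈ G, {x : E | ⟪p.1, x⟫ < p.2}) =
      ⋂ p ∈ nrm G, {x : E | ⟪p.1, x⟫ < p.2} := fun G hG =>
    polytope_eq_polytope_normalize G (Finset.mem_filter.1 hG).2
  have hpoly_bad : ∀ G ∈ 𝒢, G ∉ good → (⋂ p ∈ G, {x : E | ⟪p.1, x⟫ < p.2}) = ∅ := by
    intro G hG hGb
    have : ¬ ∀ p ∈ G, p.1 = 0 → 0 < p.2 := fun h => hGb (Finset.mem_filter.2 ⟨hG, h⟩)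
    push Not at this
    obtain ⟨p, hp, hp1, hp2⟩ := this
    exact polytope_eq_empty_of_degenerate G hp hp1 hp2
  -- the polyhedral set of a raw sub-family in normalised terms
  have hS : ∀ 𝒢' : Finset (Finset (E × ℝ)), 𝒢' ⊆ 𝒢 →
      (⋃ G ∈ 𝒢', ⋂ p ∈ G, {x : E | ⟪p.1, x⟫ < p.2}) =
        ⋃ G ∈ (𝒢'.filter (fun G => ∀ p ∈ G, p.1 = 0 → 0 < p.2)).image nrm,
          ⋂ p ∈ G, {x : E | ⟪p.1, x⟫ < p.2} := by
    intro 𝒢' h𝒢'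
    apply Subset.antisymm
    · intro x hx
      rw [mem_iUnion₂] at hx
      obtain ⟨G, hG, hxG⟩ := hx
      by_cases hGg : G ∈ good
      · refine mem_iUnion₂.2 ⟨nrm G, Finset.mem_image.2 ⟨G, Finset.mem_filter.2
          ⟨hG, (Finset.mem_filter.1 hGg).2⟩, rfl⟩, ?_⟩
        rw [← hpoly_good G hGg]; exact hxG
      · rw [hpoly_bad G (h𝒢' hG) hGg] at hxG; exact absurd hxG (notMem_empty x)
    · intro x hx
      rw [mem_iUnion₂] at hx
      obtain ⟨Gn, hGn, hxG⟩ := hx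
      obtain ⟨G, hG, rfl⟩ := Finset.mem_image.1 hGn
      have hG' := Finset.mem_filter.1 hG
      have hGg : G ∈ good := Finset.mem_filter.2 ⟨h𝒢' hG'.1, hG'.2⟩
      refine mem_iUnion₂.2 ⟨G, hG'.1, ?_⟩
      rw [hpoly_good G hGg]; exact hxG
  have hS𝒢 : (⋃ G ∈ 𝒢, ⋂ p ∈ G, {x : E | ⟪p.1, x⟫ < p.2}) =
      ⋃ G ∈ 𝒢n, ⋂ p ∈ G, {x : E | ⟪p.1, x⟫ < p.2} := by
    rw [hS 𝒢 (Finset.Subset.refl _)]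
  -- hypotheses of the full refinement
  have h1 : ∀ p ∈ 𝓗, ‖p.1‖ = 1 := by
    intro p hp
    obtain ⟨G, -, hpG⟩ := Finset.mem_biUnion.1 hp
    exact norm_fst_eq_one_of_mem_normalize G hpG
  have h𝒢n : ∀ G ∈ 𝒢n, G ⊆ 𝓗 := by
    intro G hG
    obtain ⟨G₀, hG₀, rfl⟩ := Finset.mem_image.1 hG
    exact Finset.subset_biUnion_of_mem nrm hG₀
  have hb : ∀ G ∈ 𝒢n, Bornology.IsBounded (⋂ p ∈ G, {x : E | ⟪p.1, x⟫ < p.2}) := by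
    intro G hG
    refine isBounded_hPolyhedron_of_volume_lt_top G (lt_of_le_of_lt (measure_mono ?_) hv)
    rw [hS𝒢]
    exact subset_iUnion₂ (s := fun G (_ : G ∈ 𝒢n) => ⋂ p ∈ G, {x : E | ⟪p.1, x⟫ < p.2}) G hG
  obtain ⟨k, H, ν, hne, hanti, hbd, hunit, hdist, hdisj, hplane, hsub, hae, hdich, hfam⟩ :=
    exists_disjoint_polytope_refinement_full 𝓗 h1 𝒢n h𝒢n hb
  refine ⟨k, H, ν, hne, hanti, hbd, hunit, hdist, hdisj, hplane, fun j => ?_, ?_, ?_, ?_⟩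
  · rw [hS𝒢]; exact hsub j
  · rw [hS𝒢]; exact hae
  · -- dichotomy against RAW pieces
    intro j G hG
    by_cases hGg : G ∈ good
    · rw [hpoly_good G hGg]
      exact hdich j (nrm G) (h𝒢n _ (Finset.mem_image.2 ⟨G, hGg, rfl⟩))
    · rw [hpoly_bad G hG hGg]
      exact Or.inr (disjoint_empty _)
  · -- a.e. decomposition of a RAW sub-family
    intro 𝒢' h𝒢'
    set 𝒢'n : Finset (Finset (E × ℝ)) := (𝒢'.filter (fun G => ∀ p ∈ G, p.1 = 0 → 0 < p.2)).image nrm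
      with h𝒢'n
    have hsub' : 𝒢'n ⊆ 𝒢n := by
      intro Gn hGn
      obtain ⟨G, hG, rfl⟩ := Finset.mem_image.1 hGn
      have hG' := Finset.mem_filter.1 hG
      exact Finset.mem_image.2 ⟨G, Finset.mem_filter.2 ⟨h𝒢' hG'.1, hG'.2⟩, rfl⟩
    have hfam' := hfam 𝒢'n hsub'
    rw [hS 𝒢' h𝒢']
    refine hfam'.trans (Filter.EventuallyEq.of_eq ?_)
    -- the index predicates agree (nonempty cells only see non-degenerate pieces)
    apply Set.ext
    intro x
    simp only [mem_iUnion]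
    constructor
    · rintro ⟨j, ⟨Gn, hGn, hjG⟩, hxj⟩
      obtain ⟨G, hG, rfl⟩ := Finset.mem_image.1 hGn
      have hG' := Finset.mem_filter.1 hG
      have hGg : G ∈ good := Finset.mem_filter.2 ⟨h𝒢' hG'.1, hG'.2⟩
      refine ⟨j, ⟨G, hG'.1, ?_⟩, hxj⟩
      rw [hpoly_good G hGg]; exact hjG
    · rintro ⟨j, ⟨G, hG, hjG⟩, hxj⟩
      have hGg : G ∈ good := by
        by_contra hGb
        rw [hpoly_bad G (h𝒢' hG) hGb] at hjG
        exact absurd (hjG (hne j).some_mem) (notMem_empty _)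
      refine ⟨j, ⟨nrm G, Finset.mem_image.2 ⟨G, Finset.mem_filter.2 ⟨hG, (Finset.mem_filter.1 hGg).2⟩,
        rfl⟩, ?_⟩, hxj⟩
      rw [← hpoly_good G hGg]; exact hjG

end Summit.Ventures.Crystal3D.Theorems

end
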